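import Literature.Probability.RandomPlanarGeometry.StarHullCanonical
import HarnessLib

/-!
# The one-step expansion of `d = Φ'_B(0)` and of `Y = d^{5/8}` ([LSW] Prop. 5.2, deterministic part)

For a `*`-hull `B` (canonical data `d = starDeriv B`, `E = starMap B`, jets `c₂ = E''(0)`,
`c₃ = E⁽³⁾(0)`, drift `D = starDrift B ρ₀`) and one step of the Loewner flow with increment driver
`U` run for time `u` (`B' = slidHull U B u`, `x = U_u`, `η = stepSize S u`), we expand the new
derivative `d' = Φ'_{B'}(0)` to second order in `x` and first order in `u`:

  `d' - d = c₂ x + c₃ x²/2 + u (c₂²/(2d) - (4/3) c₃) + O(u(ηρ₀ + u) + |x|³ + u|x|)`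

(`abs_starDeriv_sub_model_le`; the `u`-coefficient is `2D'(0)`, Lawler's (4.37)
`∂_t h_t'(W_t) = h_t''(W_t)²/(2h_t'(W_t)) - (4/3) h_t⁽³⁾(W_t)`), and then `Y' - Y` for `Y = d^{5/8}`
(`abs_rpow_sub_model_le`). Taking expectations over a Brownian increment (`E x = 0`,
`E x² = κ u`) the linear model has mean `u · driftCoeff κ d c₂ c₃` with

  `driftCoeff κ d c₂ c₃ = (5/8) d^{-3/8} [(κ/2) c₃ + c₂²/(2d) - (4/3) c₃] - (15/128) d^{-11/8} κ c₂²`,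

which **vanishes identically at `κ = 8/3`** (`driftCoeff_eight_thirds`): this is the computation
"`Y_t = h_t'(W_t)^{5/8}` is a local martingale iff `κ = 8/3` and `α = 5/8`" of [LSW] Prop. 5.2 /
(5.3), in the form consumed by the conditional-increment proof of the martingale property.

## References

* G. F. Lawler, O. Schramm, W. Werner, *Conformal restriction: the chordal case* (2003),
  Prop. 5.2, (5.2)–(5.3) [LawlerSchrammWerner2003Restriction].
* G. F. Lawler, *Conformally Invariant Processes in the Plane* (2005), §4.6.1 (4.35)–(4.37),
  §6.4 (6.5) [Lawler2005].
-/

noncomputable section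

open Set Filter Metric Function
open _root_.Complex _root_.Topology _root_.Real
open UpperHalfPlane (upperHalfPlaneSet)
open scoped NNReal

namespace Literature.Probability.RandomPlanarGeometry

/-! ### The drift coefficient and its vanishing at `κ = 8/3` -/

/-- **The drift coefficient of `Y = d^{5/8}` per unit time** (the `dt`-coefficient of `dY` in
[LSW] (5.3) / Lawler (6.5), divided by `Y`... written out): with `f(y) = y^{5/8}`,
`f'(d) [(κ/2) c₃ + c₂²/(2d) - (4/3) c₃] + (1/2) f''(d) κ c₂²`.
[cite: LawlerSchrammWerner2003Restriction, Prop. 5.2 (5.3)] -/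
def driftCoeff (κ d c₂ c₃ : ℝ) : ℝ :=
  (5 / 8) * d ^ (-(3 / 8 : ℝ)) * (κ / 2 * c₃ + c₂ ^ 2 / (2 * d) - 4 / 3 * c₃) +
    (1 / 2) * (-(15 / 64) * d ^ (-(11 / 8 : ℝ))) * κ * c₂ ^ 2

/-- **[LSW] Prop. 5.2 at `κ = 8/3`, `α = 5/8`: the drift vanishes identically.**
[cite: LawlerSchrammWerner2003Restriction, Prop. 5.2] -/
theorem driftCoeff_eight_thirds {d : ℝ} (hd : 0 < d) (c₂ c₃ : ℝ) : driftCoeff (8 / 3) d c₂ c₃ = 0 := by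
  rw [driftCoeff]
  have h1 : d ^ (-(11 / 8 : ℝ)) = d ^ (-(3 / 8 : ℝ)) * d⁻¹ := by
    rw [← Real.rpow_neg_one, ← Real.rpow_add hd]; norm_num
  rw [h1]
  field_simp
  ring

/-! ### Taylor expansion of `y ↦ y^{5/8}` -/

/-- **Second-order Taylor bound for `f(y) = y^{5/8}` on `[d/2, ∞)`**: for `0 < d ≤ 1` and
`|Δ| ≤ d/2`, `|f(d + Δ) - f(d) - f'(d) Δ - f''(d) Δ²/2| ≤ (d/2)^{-19/8} |Δ|³`
(`f⁽³⁾(y) = (165/512) y^{-19/8} ≤ (d/2)^{-19/8}` on the segment; mean value inequality three times).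
[folklore] -/
theorem abs_rpow_sub_taylor_le {d Δ : ℝ} (hd : 0 < d) (hΔ : |Δ| ≤ d / 2) :
    |(d + Δ) ^ (5 / 8 : ℝ) - d ^ (5 / 8 : ℝ) - 5 / 8 * d ^ (-(3 / 8 : ℝ)) * Δ -
        -(15 / 64) * d ^ (-(11 / 8 : ℝ)) * Δ ^ 2 / 2| ≤ (d / 2) ^ (-(19 / 8 : ℝ)) * |Δ| ^ 3 := by
  -- the segment `s = [d - |Δ|, d + |Δ|] ⊆ [d/2, ∞)`
  set s : Set ℝ := Icc (d - |Δ|) (d + |Δ|) with hs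
  have hsconv : Convex ℝ s := convex_Icc _ _
  have hds : d ∈ s := ⟨by linarith [abs_nonneg Δ], by linarith [abs_nonneg Δ]⟩
  have hdΔs : d + Δ ∈ s := ⟨by linarith [neg_abs_le Δ], by linarith [le_abs_self Δ]⟩
  have hspos : ∀ y ∈ s, d / 2 ≤ y ∧ 0 < y := fun y hy ↦ ⟨by linarith [hy.1], by linarith [hy.1]⟩
  -- the derivatives
  set f : ℝ → ℝ := fun y ↦ y ^ (5 / 8 : ℝ) with hf
  set f₁ : ℝ → ℝ := fun y ↦ 5 / 8 * y ^ (-(3 / 8 : ℝ)) with hf₁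
  set f₂ : ℝ → ℝ := fun y ↦ -(15 / 64) * y ^ (-(11 / 8 : ℝ)) with hf₂
  set f₃ : ℝ → ℝ := fun y ↦ 165 / 512 * y ^ (-(19 / 8 : ℝ)) with hf₃
  have hd0 : ∀ y ∈ s, HasDerivAt f (f₁ y) y := fun y hy ↦ by
    have := Real.hasDerivAt_rpow_const (p := (5 / 8 : ℝ)) (x := y) (Or.inl (hspos y hy).2.ne')
    refine this.congr_deriv ?_
    rw [hf₁, show (5 / 8 : ℝ) - 1 = -(3 / 8) by norm_num]
  have hd1 : ∀ y ∈ s, HasDerivAt f₁ (f₂ y) y := fun y hy ↦ by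
    have := (Real.hasDerivAt_rpow_const (p := (-(3 / 8) : ℝ)) (x := y) (Or.inl (hspos y hy).2.ne')).const_mul
      (5 / 8 : ℝ)
    refine this.congr_deriv ?_
    rw [hf₂, show (-(3 / 8) : ℝ) - 1 = -(11 / 8) by norm_num]
    ring
  have hd2 : ∀ y ∈ s, HasDerivAt f₂ (f₃ y) y := fun y hy ↦ by
    have := (Real.hasDerivAt_rpow_const (p := (-(11 / 8) : ℝ)) (x := y) (Or.inl (hspos y hy).2.ne')).const_mul
      (-(15 / 64) : ℝ)
    refine this.congr_deriv ?_
    rw [hf₃, show (-(11 / 8) : ℝ) - 1 = -(19 / 8) by norm_num]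
    ring
  -- `|f₃| ≤ M` on `s`
  set M : ℝ := (d / 2) ^ (-(19 / 8 : ℝ)) with hM
  have hM0 : 0 ≤ M := Real.rpow_nonneg (by positivity) _
  have hf₃le : ∀ y ∈ s, |f₃ y| ≤ M := fun y hy ↦ by
    obtain ⟨hy2, hy0⟩ := hspos y hy
    have h1 : y ^ (-(19 / 8 : ℝ)) ≤ (d / 2) ^ (-(19 / 8 : ℝ)) :=
      Real.rpow_le_rpow_of_nonpos (by positivity) hy2 (by norm_num)
    rw [hf₃, abs_of_nonneg (by positivity)]
    calc 165 / 512 * y ^ (-(19 / 8 : ℝ)) ≤ 1 * y ^ (-(19 / 8 : ℝ)) :=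
          mul_le_mul_of_nonneg_right (by norm_num) (Real.rpow_nonneg hy0.le _)
      _ ≤ M := by rw [one_mul]; exact h1
  -- mean value inequality three times, as in the complex case
  have hΔ0 : ∀ y ∈ s, |y - d| ≤ |Δ| := fun y hy ↦ abs_sub_le_iff.2 ⟨by linarith [hy.2], by linarith [hy.1]⟩
  have e3 : ∀ y ∈ s, |f₂ y - f₂ d| ≤ M * |Δ| := fun y hy ↦ by
    have := hsconv.norm_image_sub_le_of_norm_deriv_le (f := f₂) (C := M) (𝕜 := ℝ)
      (fun y hy ↦ (hd2 y hy).differentiableAt) (fun y hy ↦ by rw [(hd2 y hy).deriv]; exact hf₃le y hy) hds hy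
    rw [Real.norm_eq_abs, Real.norm_eq_abs] at this
    exact this.trans (mul_le_mul_of_nonneg_left (hΔ0 y hy) hM0)
  have e2 : ∀ y ∈ s, |f₁ y - f₁ d - f₂ d * (y - d)| ≤ M * |Δ| ^ 2 := fun y hy ↦ by
    have hG : ∀ w ∈ s, HasDerivAt (fun w ↦ f₁ w - f₂ d * (w - d)) (f₂ w - f₂ d) w := fun w hw ↦ by
      have := (hd1 w hw).sub (((hasDerivAt_id w).sub_const d).const_mul (f₂ d))
      rw [mul_one] at this
      exact this
    have := hsconv.norm_image_sub_le_of_norm_deriv_le (f := fun w ↦ f₁ w - f₂ d * (w - d)) (C := M * |Δ|) (𝕜 := ℝ)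
      (fun w hw ↦ (hG w hw).differentiableAt) (fun w hw ↦ by
        rw [(hG w hw).deriv, Real.norm_eq_abs]; exact e3 w hw) hds hy
    rw [Real.norm_eq_abs, Real.norm_eq_abs, sub_self, mul_zero, sub_zero] at this
    calc |f₁ y - f₁ d - f₂ d * (y - d)| = |f₁ y - f₂ d * (y - d) - f₁ d| := by ring_nf
      _ ≤ M * |Δ| * |y - d| := this
      _ ≤ M * |Δ| * |Δ| := mul_le_mul_of_nonneg_left (hΔ0 y hy) (by positivity)
      _ = M * |Δ| ^ 2 := by ring
  have hG : ∀ w ∈ s, HasDerivAt (fun w ↦ f w - f₁ d * (w - d) - f₂ d * (w - d) ^ 2 / 2)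
      (f₁ w - f₁ d - f₂ d * (w - d)) w := fun w hw ↦ by
    have := ((hd0 w hw).sub (((hasDerivAt_id w).sub_const d).const_mul (f₁ d))).sub
      (((((hasDerivAt_id w).sub_const d).pow 2).const_mul (f₂ d)).div_const 2)
    refine this.congr_deriv ?_
    simp only [id_eq, mul_one, Nat.cast_ofNat]
    ring
  have := hsconv.norm_image_sub_le_of_norm_deriv_le
    (f := fun w ↦ f w - f₁ d * (w - d) - f₂ d * (w - d) ^ 2 / 2) (C := M * |Δ| ^ 2) (𝕜 := ℝ)
    (fun w hw ↦ (hG w hw).differentiableAt) (fun w hw ↦ by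
      rw [(hG w hw).deriv, Real.norm_eq_abs]; exact e2 w hw) hds hdΔs
  rw [Real.norm_eq_abs, Real.norm_eq_abs] at this
  simp only [sub_self, mul_zero, ne_eq, OfNat.ofNat_ne_zero, not_false_eq_true, zero_pow, zero_div,
    sub_zero, add_sub_cancel_left] at this
  calc _ = |f (d + Δ) - f₁ d * Δ - f₂ d * Δ ^ 2 / 2 - f d| := by simp only [hf, hf₁, hf₂]; ring_nf
    _ ≤ M * |Δ| ^ 2 * |Δ| := this
    _ = M * |Δ| ^ 3 := by ring

/-! ### The expansion of `d' - d` -/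

namespace Loewner

variable {B : Set ℂ} {ρ₀ : ℝ} {U : ℝ≥0 → ℝ} {u : ℝ≥0} {S : ℝ}
variable (hB : IsStarHull B) (hU : Continuous U) (hU0 : U 0 = 0) (hu : 0 < u)
  (hS : ∀ v : ℝ≥0, v ≤ u → |U v| ≤ S) (hρ₀ : 0 < ρ₀) (hBρ : Disjoint (ball (0 : ℂ) (8 * ρ₀)) B)
  (hη : stepSize S u ≤ starDeriv B * ρ₀ / 1000)

/-- The real jets `c₂ = E_B''(0)`, `c₃ = E_B⁽³⁾(0)` of a `*`-hull. [folklore] -/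
def starJet2 (B : Set ℂ) : ℝ := (deriv (deriv (starMap B)) 0).re

/-- See `starJet2`. [folklore] -/
def starJet3 (B : Set ℂ) : ℝ := (deriv (deriv (deriv (starMap B))) 0).re

include hB hρ₀ hBρ in
/-- The jets are real: `E_B''(0) = c₂`, `E_B⁽³⁾(0) = c₃`, and `|c₂| ≤ 1/ρ₀`, `|c₃| ≤ 2/ρ₀²`;
moreover `D'(0) = c₂²/(4d) - (2/3) c₃`. [folklore] -/
theorem starJet_spec :
    deriv (deriv (starMap B)) 0 = (starJet2 B : ℂ) ∧ deriv (deriv (deriv (starMap B))) 0 = (starJet3 B : ℂ) ∧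
      |starJet2 B| ≤ 1 / ρ₀ ∧ |starJet3 B| ≤ 2 / ρ₀ ^ 2 ∧
      deriv (starDrift B ρ₀) 0 =
        ((starJet2 B ^ 2 / (4 * starDeriv B) - 2 / 3 * starJet3 B : ℝ) : ℂ) := by
  have hΦ := isRestrictionMap_starRMap hB
  have hd := (starDeriv_spec hB).2.2
  obtain ⟨-, h2, h3⟩ := im_iteratedDeriv_hullExt_ofReal hB hΦ hρ₀ hBρ (x := 0) (by rw [abs_zero]; positivity)
  rw [ofReal_zero, ← starMap_eq hB] at h2 h3
  obtain ⟨-, hb2, hb3, -⟩ := norm_iteratedDeriv_hullExt_le hB hΦ hρ₀ hBρ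
  have e2 : deriv (deriv (starMap B)) 0 = (starJet2 B : ℂ) := by
    apply Complex.ext <;> simp [starJet2, h2]
  have e3 : deriv (deriv (deriv (starMap B))) 0 = (starJet3 B : ℂ) := by
    apply Complex.ext <;> simp [starJet3, h3]
  refine ⟨e2, e3, ?_, ?_, ?_⟩
  · have := hb2 0 (mem_closedBall_self hρ₀.le)
    rwa [← starMap_eq hB, e2, norm_real, Real.norm_eq_abs] at this
  · have := hb3 0 (mem_closedBall_self (by positivity))
    rwa [← starMap_eq hB, e3, norm_real, Real.norm_eq_abs] at this
  · have hD := hasDerivAt_driftFun_zero hB hΦ hd hρ₀ hBρ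
    rw [← starMap_eq hB, ← starDrift_eq hB, e2, e3] at hD
    rw [hD.deriv]
    push_cast
    ring

include hB hU hU0 hu hS hρ₀ hBρ hη in
/-- **The expansion of `d' - d`** ([LSW] (5.3) / Lawler (4.37), quantitative, deterministic): with
`x = U_u`, `η = stepSize S u`, `c₂ = E_B''(0)`, `c₃ = E_B⁽³⁾(0)`, `d = Φ'_B(0)`, `d' = Φ'_{B'}(0)`,

  `|d' - d - (c₂ x + c₃ x²/2 + u (c₂²/(2d) - (4/3) c₃))|`
  `≤ 200000 u (η ρ₀ + u)/(d ρ₀⁴) + (8/ρ₀³) |x|³ + (6144/ρ₀³) u |x|`: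

`d' = E_{B'}'(0) = E_B'(x) + 2u D'(x) + O(u(ηρ₀+u))` (`norm_deriv_starStep_sub_drift_le` at `z = x`),
`E_B'(x) = d + c₂ x + c₃ x²/2 + O(|x|³)`, `D'(x) = D'(0) + O(|x|)`, `2D'(0) = c₂²/(2d) - (4/3)c₃`.
[cite: LawlerSchrammWerner2003Restriction, Prop. 5.2 (5.3); Lawler2005, (4.37)] -/
theorem abs_starDeriv_sub_model_le :
    |starDeriv (slidHull U B u) - starDeriv B -
        (starJet2 B * U u + starJet3 B * U u ^ 2 / 2 +
          u * (starJet2 B ^ 2 / (2 * starDeriv B) - 4 / 3 * starJet3 B))| ≤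
      200000 * u * (stepSize S u * ρ₀ + u) / (starDeriv B * ρ₀ ^ 4) + 8 / ρ₀ ^ 3 * |U u| ^ 3 +
        6144 / ρ₀ ^ 3 * u * |U u| := by
  obtain ⟨hUu, hη1, hη0⟩ := abs_driver_le hB hu hS hρ₀ hη
  obtain ⟨hd0, hd1, hd⟩ := starDeriv_spec hB
  obtain ⟨-, hB'⟩ := isStarHull_slidHull_canonical hB hU hU0 hS hρ₀ hBρ hη
  have hΦ := isRestrictionMap_starRMap hB
  obtain ⟨e2, e3, -, -, eD⟩ := starJet_spec hB hρ₀ hBρ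
  set x : ℝ := U u with hx
  have hxρ : |x| ≤ ρ₀ / 1000 := hUu.trans hη1
  have hxn : ‖(x : ℂ)‖ = |x| := by rw [norm_real, Real.norm_eq_abs]
  -- (1) the step at `z = x`
  have h1 := norm_deriv_starStep_sub_drift_le hB hU hU0 hu hS hρ₀ hBρ hη (z := x) (by rw [hxn]; linarith)
  rw [sub_self, deriv_starMap_zero hB'] at h1
  -- (2) Taylor of `E_B'` at `0`
  have h2 := norm_deriv_hullExt_sub_taylor_le hB hΦ hd hρ₀ hBρ (z := x) (by rw [hxn]; linarith)
  rw [← starMap_eq hB, e2, e3, hxn] at h2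
  -- (3) `D'(x) - D'(0)`
  have h3 := norm_deriv_driftFun_sub_le hB hΦ hd hρ₀ hBρ (z := x) (by rw [hxn]; linarith)
  rw [← starDrift_eq hB, eD, hxn] at h3
  -- combine
  have hid : ((starDeriv (slidHull U B u) - starDeriv B -
        (starJet2 B * x + starJet3 B * x ^ 2 / 2 +
          u * (starJet2 B ^ 2 / (2 * starDeriv B) - 4 / 3 * starJet3 B)) : ℝ) : ℂ) =
      ((starDeriv (slidHull U B u) : ℂ) - deriv (starMap B) x - 2 * (u : ℂ) * deriv (starDrift B ρ₀) x) +
        (deriv (starMap B) x - starDeriv B - (starJet2 B : ℂ) * x - (starJet3 B : ℂ) * x ^ 2 / 2) +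
        2 * (u : ℂ) * (deriv (starDrift B ρ₀) x -
          ((starJet2 B ^ 2 / (4 * starDeriv B) - 2 / 3 * starJet3 B : ℝ) : ℂ)) := by
    push_cast
    ring
  rw [← Real.norm_eq_abs, ← norm_real, hid]
  refine (norm_add_le _ _).trans (add_le_add ((norm_add_le _ _).trans (add_le_add h1 h2)) ?_)
  rw [norm_mul, norm_mul, Complex.norm_two, Complex.norm_of_nonneg u.coe_nonneg]
  calc 2 * (u : ℝ) * ‖deriv (starDrift B ρ₀) x - ((starJet2 B ^ 2 / (4 * starDeriv B) - 2 / 3 * starJet3 B : ℝ) : ℂ)‖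
      ≤ 2 * u * (3072 / ρ₀ ^ 3 * |x|) := mul_le_mul_of_nonneg_left h3 (by positivity)
    _ = 6144 / ρ₀ ^ 3 * u * |x| := by ring

include hB hU hU0 hu hS hρ₀ hBρ hη in
/-- **Crude bounds**: `|d' - d| ≤ 50u/ρ₀² + 2η/ρ₀ ≤ d/400` (so `d' ∈ [d/2, 2d]`). [folklore] -/
theorem abs_starDeriv_sub_le_crude :
    |starDeriv (slidHull U B u) - starDeriv B| ≤ 50 * u / ρ₀ ^ 2 + 2 * stepSize S u / ρ₀ ∧
      50 * u / ρ₀ ^ 2 + 2 * stepSize S u / ρ₀ ≤ starDeriv B / 400 := by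
  have h := abs_starDeriv_slidHull_sub_le hB hU hU0 hu hS hρ₀ hBρ hη
  obtain ⟨hd0, hd1, -⟩ := starDeriv_spec hB
  obtain ⟨-, -, hη0, hη1, huη, huρ⟩ := stepSize_small hB (isRestrictionMap_starRMap hB) (starDeriv_spec hB).2.2 hu hS hρ₀ hη
  refine ⟨h, ?_⟩
  -- `u ≤ η²/16 ≤ η · dρ₀/16000`, so `50u/ρ₀² ≤ d η/(320 ρ₀) ≤ d/320000`; `2η/ρ₀ ≤ d/500`
  have h1 : 2 * stepSize S u / ρ₀ ≤ starDeriv B / 500 := by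
    rw [div_le_div_iff₀ hρ₀ (by norm_num)]; nlinarith
  have h2 : 50 * u / ρ₀ ^ 2 ≤ starDeriv B / 2000 := by
    rw [div_le_div_iff₀ (by positivity) (by norm_num)]
    have hη2 : stepSize S u ^ 2 ≤ (starDeriv B * ρ₀ / 1000) ^ 2 := pow_le_pow_left₀ hη0.le hη 2
    have hu1 : (u : ℝ) ≤ (starDeriv B * ρ₀ / 1000) ^ 2 / 16 := huη.trans (by linarith)
    have hdd : starDeriv B ^ 2 * ρ₀ ^ 2 ≤ starDeriv B * ρ₀ ^ 2 := by
      have := mul_le_mul_of_nonneg_left hd1 (by positivity : (0 : ℝ) ≤ starDeriv B * ρ₀ ^ 2)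
      nlinarith [this]
    nlinarith [hu1, hdd]
  linarith

end Loewner

/-! ### The expansion of `Y' - Y` -/

namespace Loewner

variable {B : Set ℂ} {ρ₀ : ℝ} {U : ℝ≥0 → ℝ} {u : ℝ≥0} {S : ℝ}
variable (hB : IsStarHull B) (hU : Continuous U) (hU0 : U 0 = 0) (hu : 0 < u)
  (hS : ∀ v : ℝ≥0, v ≤ u → |U v| ≤ S) (hρ₀ : 0 < ρ₀) (hBρ : Disjoint (ball (0 : ℂ) (8 * ρ₀)) B)
  (hη : stepSize S u ≤ starDeriv B * ρ₀ / 1000)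

/-- **The linear model of the increment of `Y = d^{5/8}`**: with `f(y) = y^{5/8}`,
`f'(d)(c₂ x + c₃ x²/2 + u (c₂²/(2d) - (4/3)c₃)) + (1/2) f''(d) c₂² x²`. Its mean over a Brownian
increment `x` (`E x = 0`, `E x² = κu`) is `u · driftCoeff κ d c₂ c₃`. [cite: LawlerSchrammWerner2003Restriction, Prop. 5.2 (5.3)] -/
def stepModel (d c₂ c₃ : ℝ) (u : ℝ≥0) (x : ℝ) : ℝ :=
  5 / 8 * d ^ (-(3 / 8 : ℝ)) * (c₂ * x + c₃ * x ^ 2 / 2 + u * (c₂ ^ 2 / (2 * d) - 4 / 3 * c₃)) +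
    1 / 2 * (-(15 / 64) * d ^ (-(11 / 8 : ℝ))) * c₂ ^ 2 * x ^ 2

/-- The model is `(linear in x) + (driftCoeff-type) · x² + (…) · u`: replacing `x²` by `κ u` and
dropping the linear term gives `u · driftCoeff`. [folklore] -/
theorem stepModel_eq (d c₂ c₃ : ℝ) (u : ℝ≥0) (x : ℝ) (κ : ℝ) :
    stepModel d c₂ c₃ u x =
      5 / 8 * d ^ (-(3 / 8 : ℝ)) * c₂ * x +
        (5 / 8 * d ^ (-(3 / 8 : ℝ)) * (c₃ / 2) + 1 / 2 * (-(15 / 64) * d ^ (-(11 / 8 : ℝ))) * c₂ ^ 2) *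
          (x ^ 2 - κ * u) +
        u * driftCoeff κ d c₂ c₃ := by
  rw [stepModel, driftCoeff]; ring

/-- **The expansion of `Y' - Y`, real-variable form**: if `|d' - d - P| ≤ R` for the model
polynomial `P = c₂ x + c₃ x²/2 + u (c₂²/(2d) - (4/3)c₃)`, `|d' - d| ≤ β ≤ d/2`, `|x| ≤ η`,
`|c₂| ≤ 1/ρ₀`, `|c₃| ≤ 2/ρ₀²`, then `Y' - Y - stepModel` is bounded by the Taylor remainder
`(d/2)^{-19/8} β³`, plus `(5/8) d^{-3/8} R`, plus the cross term
`(15/128) d^{-11/8} (2η²/ρ₀² + u(1/(dρ₀²) + 3/ρ₀²) + R)(β + η/ρ₀)`. [folklore] -/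
theorem abs_rpow_sub_stepModel_le_of {d d' c₂ c₃ x η ρ₀ R β : ℝ} {u : ℝ≥0} (hd0 : 0 < d) (hρ₀ : 0 < ρ₀)
    (hx : |x| ≤ η) (hc2 : |c₂| ≤ 1 / ρ₀) (hc3 : |c₃| ≤ 2 / ρ₀ ^ 2)
    (hR : |d' - d - (c₂ * x + c₃ * x ^ 2 / 2 + u * (c₂ ^ 2 / (2 * d) - 4 / 3 * c₃))| ≤ R)
    (hβ : |d' - d| ≤ β) (hβd : β ≤ d / 2) :
    |d' ^ (5 / 8 : ℝ) - d ^ (5 / 8 : ℝ) - stepModel d c₂ c₃ u x| ≤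
      (d / 2) ^ (-(19 / 8 : ℝ)) * β ^ 3 + 5 / 8 * d ^ (-(3 / 8 : ℝ)) * R +
        15 / 128 * d ^ (-(11 / 8 : ℝ)) *
          ((2 / ρ₀ ^ 2 * η ^ 2 + u * (1 / (d * ρ₀ ^ 2) + 3 / ρ₀ ^ 2) + R) * (β + η / ρ₀)) := by
  have hu0 : (0 : ℝ) ≤ u := u.coe_nonneg
  have hΔd : |d' - d| ≤ d / 2 := hβ.trans hβd
  -- Taylor of `y^{5/8}`
  have hT := abs_rpow_sub_taylor_le hd0 hΔd
  rw [add_sub_cancel] at hT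
  -- decomposition of the error: Taylor remainder + linear piece + quadratic cross term
  have hdecomp : d' ^ (5 / 8 : ℝ) - d ^ (5 / 8 : ℝ) - stepModel d c₂ c₃ u x =
      (d' ^ (5 / 8 : ℝ) - d ^ (5 / 8 : ℝ) - 5 / 8 * d ^ (-(3 / 8 : ℝ)) * (d' - d) -
          -(15 / 64) * d ^ (-(11 / 8 : ℝ)) * (d' - d) ^ 2 / 2) +
        5 / 8 * d ^ (-(3 / 8 : ℝ)) * (d' - d - (c₂ * x + c₃ * x ^ 2 / 2 + u * (c₂ ^ 2 / (2 * d) - 4 / 3 * c₃))) +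
        -(15 / 128) * d ^ (-(11 / 8 : ℝ)) * ((d' - d - c₂ * x) * (d' - d + c₂ * x)) := by
    rw [stepModel]; ring
  rw [hdecomp]
  -- bounds on the pieces
  have hc2x : |c₂ * x| ≤ η / ρ₀ := by
    rw [abs_mul]
    calc |c₂| * |x| ≤ 1 / ρ₀ * η := mul_le_mul hc2 hx (abs_nonneg _) (by positivity)
      _ = η / ρ₀ := by ring
  have h3 : |c₃ * x ^ 2 / 2| ≤ 2 / ρ₀ ^ 2 * η ^ 2 := by
    rw [abs_div, abs_mul, abs_pow, abs_two]
    have hx2 : |x| ^ 2 ≤ η ^ 2 := pow_le_pow_left₀ (abs_nonneg _) hx 2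
    have := mul_le_mul hc3 hx2 (by positivity) (by positivity)
    have h' : 0 ≤ 2 / ρ₀ ^ 2 * η ^ 2 := by positivity
    linarith only [this, h']
  have h4a : |c₂ ^ 2 / (2 * d)| ≤ 1 / (d * ρ₀ ^ 2) := by
    rw [abs_div, abs_of_pos (by positivity : (0 : ℝ) < 2 * d), abs_of_nonneg (sq_nonneg _),
      div_le_div_iff₀ (by positivity) (by positivity)]
    have hc2' : c₂ ^ 2 ≤ (1 / ρ₀) ^ 2 := by
      rw [← sq_abs]; exact pow_le_pow_left₀ (abs_nonneg _) hc2 2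
    have h5 : c₂ ^ 2 * (d * ρ₀ ^ 2) ≤ (1 / ρ₀) ^ 2 * (d * ρ₀ ^ 2) :=
      mul_le_mul_of_nonneg_right hc2' (by positivity)
    have h' : (1 / ρ₀) ^ 2 * (d * ρ₀ ^ 2) = d := by field_simp
    have hd' : d ≤ 1 * (2 * d) := by linarith only [hd0]
    linarith only [h5, h', hd']
  have h4b : |4 / 3 * c₃| ≤ 3 / ρ₀ ^ 2 := by
    rw [abs_mul, show |(4 : ℝ) / 3| = 4 / 3 by norm_num]
    have := mul_le_mul_of_nonneg_left hc3 (by norm_num : (0 : ℝ) ≤ 4 / 3)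
    have h' : 4 / 3 * (2 / ρ₀ ^ 2) ≤ 3 / ρ₀ ^ 2 := by
      rw [← mul_div_assoc, div_le_div_iff_of_pos_right (by positivity)]
      norm_num
    linarith only [this, h']
  have h4 : |(u : ℝ) * (c₂ ^ 2 / (2 * d) - 4 / 3 * c₃)| ≤ u * (1 / (d * ρ₀ ^ 2) + 3 / ρ₀ ^ 2) := by
    rw [abs_mul, abs_of_nonneg hu0]
    exact mul_le_mul_of_nonneg_left ((abs_sub _ _).trans (add_le_add h4a h4b)) hu0
  have hPc : |c₃ * x ^ 2 / 2 + u * (c₂ ^ 2 / (2 * d) - 4 / 3 * c₃)| ≤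
      2 / ρ₀ ^ 2 * η ^ 2 + u * (1 / (d * ρ₀ ^ 2) + 3 / ρ₀ ^ 2) := (abs_add_le _ _).trans (add_le_add h3 h4)
  have hΔc : |d' - d - c₂ * x| ≤ 2 / ρ₀ ^ 2 * η ^ 2 + u * (1 / (d * ρ₀ ^ 2) + 3 / ρ₀ ^ 2) + R := by
    have h1 : d' - d - c₂ * x = (d' - d - (c₂ * x + c₃ * x ^ 2 / 2 + u * (c₂ ^ 2 / (2 * d) - 4 / 3 * c₃))) +
        (c₃ * x ^ 2 / 2 + u * (c₂ ^ 2 / (2 * d) - 4 / 3 * c₃)) := by ring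
    rw [h1]
    have := abs_add_le (d' - d - (c₂ * x + c₃ * x ^ 2 / 2 + u * (c₂ ^ 2 / (2 * d) - 4 / 3 * c₃)))
      (c₃ * x ^ 2 / 2 + u * (c₂ ^ 2 / (2 * d) - 4 / 3 * c₃))
    linarith only [this, hR, hPc]
  have hΔc' : |d' - d + c₂ * x| ≤ β + η / ρ₀ := (abs_add_le _ _).trans (add_le_add hβ hc2x)
  -- assemble: `|T + A + C| ≤ |T| + |A| + |C|`
  refine (abs_add_le _ _).trans (add_le_add ((abs_add_le _ _).trans (add_le_add ?_ ?_)) ?_)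
  · exact hT.trans (mul_le_mul_of_nonneg_left (pow_le_pow_left₀ (abs_nonneg _) hβ 3)
      (Real.rpow_nonneg (by positivity) _))
  · rw [abs_mul, abs_of_nonneg (by positivity : (0 : ℝ) ≤ 5 / 8 * d ^ (-(3 / 8 : ℝ)))]
    exact mul_le_mul_of_nonneg_left hR (by positivity)
  · rw [abs_mul, abs_mul, abs_mul, abs_neg, abs_of_nonneg (by norm_num : (0 : ℝ) ≤ 15 / 128),
      abs_of_nonneg (Real.rpow_nonneg hd0.le _)]
    have hR0 : 0 ≤ 2 / ρ₀ ^ 2 * η ^ 2 + u * (1 / (d * ρ₀ ^ 2) + 3 / ρ₀ ^ 2) + R :=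
      (abs_nonneg _).trans hΔc
    exact mul_le_mul_of_nonneg_left (mul_le_mul hΔc hΔc' (abs_nonneg _) hR0) (by positivity)

include hB hU hU0 hu hS hρ₀ hBρ hη in
/-- **The expansion of `Y' - Y`** for the step (`Y = d^{5/8}`, `Y' = d'^{5/8}`, `d = Φ'_B(0)`,
`d' = Φ'_{B'}(0)`): `|Y' - Y - stepModel d c₂ c₃ u x|` is bounded by an explicit polynomial in
`(u, η)` with coefficients depending on `(d, ρ₀)` only, of size `O(u(ηρ₀ + u) + η³ + uη + u²)`
(all error terms of `abs_starDeriv_sub_model_le` with `|x| ≤ η`, the quadratic cross term and the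
Taylor remainder of `y^{5/8}`, with `|d' - d| ≤ β = 50u/ρ₀² + 2η/ρ₀ ≤ d/400`).
[cite: LawlerSchrammWerner2003Restriction, Prop. 5.2 (5.3)] -/
theorem abs_rpow_sub_stepModel_le :
    |starDeriv (slidHull U B u) ^ (5 / 8 : ℝ) - starDeriv B ^ (5 / 8 : ℝ) -
        stepModel (starDeriv B) (starJet2 B) (starJet3 B) u (U u)| ≤
      (starDeriv B / 2) ^ (-(19 / 8 : ℝ)) * (50 * u / ρ₀ ^ 2 + 2 * stepSize S u / ρ₀) ^ 3 +
        5 / 8 * starDeriv B ^ (-(3 / 8 : ℝ)) *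
          (200000 * u * (stepSize S u * ρ₀ + u) / (starDeriv B * ρ₀ ^ 4) +
            8 / ρ₀ ^ 3 * stepSize S u ^ 3 + 6144 / ρ₀ ^ 3 * u * stepSize S u) +
        15 / 128 * starDeriv B ^ (-(11 / 8 : ℝ)) *
          ((2 / ρ₀ ^ 2 * stepSize S u ^ 2 + u * (1 / (starDeriv B * ρ₀ ^ 2) + 3 / ρ₀ ^ 2) +
              (200000 * u * (stepSize S u * ρ₀ + u) / (starDeriv B * ρ₀ ^ 4) +
                8 / ρ₀ ^ 3 * stepSize S u ^ 3 + 6144 / ρ₀ ^ 3 * u * stepSize S u)) *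
            (50 * u / ρ₀ ^ 2 + 2 * stepSize S u / ρ₀ + stepSize S u / ρ₀)) := by
  obtain ⟨hUu, hη1, hη0⟩ := abs_driver_le hB hu hS hρ₀ hη
  obtain ⟨hd0, hd1, hd⟩ := starDeriv_spec hB
  obtain ⟨-, -, hc2, hc3, -⟩ := starJet_spec hB hρ₀ hBρ
  have hmain := abs_starDeriv_sub_model_le hB hU hU0 hu hS hρ₀ hBρ hη
  obtain ⟨hcrude, hsmall⟩ := abs_starDeriv_sub_le_crude hB hU hU0 hu hS hρ₀ hBρ hη
  have hu0 : (0 : ℝ) ≤ u := u.coe_nonneg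
  -- replace `|x|` by `η` in the remainder
  have hR : |starDeriv (slidHull U B u) - starDeriv B -
      (starJet2 B * U u + starJet3 B * U u ^ 2 / 2 +
        u * (starJet2 B ^ 2 / (2 * starDeriv B) - 4 / 3 * starJet3 B))| ≤
      200000 * u * (stepSize S u * ρ₀ + u) / (starDeriv B * ρ₀ ^ 4) +
        8 / ρ₀ ^ 3 * stepSize S u ^ 3 + 6144 / ρ₀ ^ 3 * u * stepSize S u := by
    have e1 : |U u| ^ 3 ≤ stepSize S u ^ 3 := pow_le_pow_left₀ (abs_nonneg _) hUu 3
    have e3 : 8 / ρ₀ ^ 3 * |U u| ^ 3 ≤ 8 / ρ₀ ^ 3 * stepSize S u ^ 3 := mul_le_mul_of_nonneg_left e1 (by positivity)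
    have e4 : 6144 / ρ₀ ^ 3 * u * |U u| ≤ 6144 / ρ₀ ^ 3 * u * stepSize S u :=
      mul_le_mul_of_nonneg_left hUu (by positivity)
    linarith only [hmain, e3, e4]
  exact abs_rpow_sub_stepModel_le_of hd0 hρ₀ hUu hc2 hc3 hR hcrude (by linarith only [hsmall, hd0])

end Loewner

end Literature.Probability.RandomPlanarGeometry
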